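import Summits.Ventures.HSemireg.Pad4TowerFCCoreParitySeam

/-!
# Venture HSemireg — PAD-4 on 𝔅(μ₄): LEMMA Ψ-LINE (on a line cell `Ψ = Π_f c_f`, the FC charge product) and the PROPOSITION
# «Ψ-ROW balanced against the signed FC charge products ⇒ Re μ = 0 ⇒ only the ODD core can carry μ» — K-free, every height, no static hypothesis

HONEST FRAMING. Lean index of the computation cell `pub-hsemireg` (S4-PUSH, H2 door PAD-4), typed by the Ventures-side typer
`hodge-lit-semireg-typer-2` (g5; line of record stmt-HodgeConjecture-18881 `Cruxes/BlochSeedDiscOne/Lines/birth.lean` 814a6a70c14e831a,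
stub `stub_rung_pad4_seedAt`, screen (H1) = the class condition (A1)). Fourteenth file of the KERNEL LEMMA Ψ ⊂ (A1) set; sequel of (B)
`Pad4TowerPsiSubA1` (p595255: `MCell.psiQ ∕ psi12`, **the Ψ-ROW** `psiRow_of_classScreen`), of 840 `Pad4FCCore` (p588880: the sixteen identities
`8x_κ = ±Re μ ∕ ±Im μ`) and of (J) `Pad4TowerFCCoreParitySeam` (p612407: `mixedRowsVanish_of_classScreen_axis`, `mu_fcCore_axis` — FC-CORE for
every weighted 𝔅(μ₄) configuration with axis FC cells, `xPat` = signed parity aggregates). SOURCE SENTENCE (gs-eng-2 g52, LEMMA-PSILINE-gs2g52.md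
29a7a573fca0eec0, cell INBOX l.32401, written as LINE 5 input after the attribution batch j302131 «V1 STATIC+FC-CORE UNSAT ×2, V2 STATIC+Ψ UNSAT
×2»): «§1 LEMMA Ψ-LINE. If x_f, x_g lie on the same line (ceiling of height h, or floor) then T_{fg} = 2 c_f c_g. Hence for a LINE CELL Z:
Ψ(Z) = c₁c₂c₃c₄ = C_Z (= 0 unless Z is fully charged; = the FC weight of LEMMA FC-CORE when it is). §2 PROPOSITION (Ψ-ROW = FC-CORE SUM ⇒
Re μ = 0). Put δ(Z) := Ψ(Z) − [Z FC]·C_Z. If a two-level support S with multiplicities m satisfies (A1) and Σ_Z ε m δ(Z) = 0 (in particular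
if δ ≡ 0 on S), then Re μ = 0. PROOF. Ψ-row: 0 = Σ ε m Ψ = Σ ε m δ + Σ_{FC} ε m C_Z = 0 + Σ_κ x_κ; and by FC-CORE Σ_κ x_κ = (1∕8)(2·Re μ −
6·Re μ + 4·Im μ − 4·Im μ) = −Re μ∕2. ∎ COROLLARY. On such a support (H1) needs Im μ ≠ 0, i.e. the ODD core … the EVEN core cannot be
completed on it.» THIS FILE proves §1 as a ring identity for arbitrary factor points, and §2 + COROLLARY for every weighted 𝔅(μ₄) configuration
whose fully charged classes are axis cells, with ONE precision forced by the frame (FLAG, stated in every docstring): the `x_κ` of FC-CORE on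
𝔅(μ₄) are the SIGNED aggregates ((J) `xPat`, charge product `C±_Z = MCell.cprod` carrying the antipodal sign), so the defect that makes §2's
one-line proof go through is the SIGNED defect `δ(Z) = Ψ(Z) − [FC]·C±_Z` (`MCell.psiDefect`); on WINDOW cells (`𝒜_{1,i}`, where the note's
§1∕FC-CORE §1 live and `C± = C > 0`) it is the note's δ verbatim, and §1 gives `δ = 0` on every window line cell (`psiDefect_eq_zero_of_line`);
on antipodal-phase line cells `Ψ = |C±|` (`psiQ_ceiling_abs`) and the signed defect is `|C±| − C±`.

CONTENT (all PROVED; no `sorry`; axioms standard).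
* §1 **`MCell.psi12_ceiling`** ∕ **`MCell.psi12_floor`** (`|β_f|² = (h − α_f)²` on every factor ⇒ `12Ψ = 12·Π(h − α_f)`; `|β_f|² = α_f²` ⇒
  `12Ψ = 12·Πα_f` — `ring`), `psiQ_ceiling ∕ psiQ_floor`.
* §2 `normSq_eq_chargeOf_sq` (axis letters: `|β|² = chargeOf²`), **`MCell.psiQ_eq_cprod_of_ceiling`** (`α_f + chargeOf_f = h` ⇒ `Ψ = C±`),
  **`MCell.psiQ_eq_cprod_of_floor`** (`α_f = chargeOf_f` ⇒ `Ψ = C±`), `MCell.psiQ_ceiling_abs` (`α_f + |chargeOf_f| = h` ⇒ `Ψ = Π|chargeOf| = |C±|`),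
  `MCell.cprod_eq_zero_of_uncharged` (Ψ-null line cells through `hI` ∕ `O`).
* §3 `MCell.psiDefect` (signed), `psiDefect_eq_zero_of_line`; **`sum_x_of_mixedRowsVanish`** (`Σ_κ x_κ = −muRe∕2`, the sum of 840's sixteen
  identities), `MConfig.sum_xPat` (`Σ_κ X_κ` = the FC charge-product row); **`MConfig.muRe_eq_zero_of_psiDefect_balance`**: axis FC cells +
  (A1) + `Σ_N m δ = Σ_P m δ` ⇒ `Re wch(ēēēē) = 0 = Re wch(eeee)`; **`MConfig.odd_core_of_psiDefect_balance`**: + `wch(eeee) ≠ 0` ⇒ `Im ≠ 0` and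
  present FC classes of parity patterns `0001` AND `0111` (weights 1 and 3; (J) `HasFC`).
* §4 probes (`decide`): the height-8 ceiling unit cell `[6I+ℓ_u]⁴` (`12Ψ = 12`, `C± = 1`, `δ = 0`) and the off-line cell `[4I|ℓ|ℓ|ℓ]`
  (`12Ψ = −48`, not FC).

WHAT IS NOT HERE ∕ NOT IN LEAN. Whether static-clean supports are δ-balanced ((CUL)∕(L5-a): evidence 14∕14 in the note, not a theorem); the
note's machine checks (7 060 line cells; 1 915 classes); supports with `Σ ε m δ ≠ 0`; 919's sign menu restated (import `Pad4TowerFCCoreSigns` for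
`HasSignedFC` if wanted — not needed here); any static rule, encoder, SAT verdict; nothing here is an object or a census row. The frame's
identification with `H^{ev}(S⁴)` and of the screen with PAD4-FIRSTORDER §0's (A1)-target stays the cell's pencil modelling sentence (as for
840 ∕ (B) ∕ (J)). No variety, sheaf, σ, seed or abelian variety; NOTHING HERE SAYS THAT HC ∕ HC_CM ∕ HC_AV ∕ W₆ ∕ HC_Kum4Type HOLDS OR FAILS.
No `instance`, no notation, no named fact, 0 `sorry`.

SOURCES (sha16 ∕ bus): LEMMA-PSILINE-gs2g52.md 29a7a573fca0eec0 (§1, §2, COROLLARY, §3 (iv) typing offer to typer-2); OBS-CEILING-UNIT-CELL-gs2g52.md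
5227a11a738754a2; attribution j302131 (bc5-plan g7 l.32378); (B) `Pad4TowerPsiSubA1.lean` 8a8ffcebf99475df p595255; `Pad4FCCore.lean` 77cf033c04df8791
p588880; (F) `Pad4TowerFCCoreSeam.lean` afb1e6d84449a076 p603640; (J) `Pad4TowerFCCoreParitySeam.lean` cbe3f9cea9813991 p612407. -/

namespace Summit.Ventures.HSemireg.Pad4Tower

open Finset

/-! ## §1 LEMMA Ψ-LINE: on a line cell `12Ψ = 12·Π_f c_f` (pure algebra, any factor points) -/

/-- **LEMMA Ψ-LINE, CEILING**: if every letter of the cell lies on the ceiling line of height `h` — `|β_f|² = (h − α_f)²`, i.e. own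
coordinate `a = h∕2`, charge `c_f = h − α_f` — then every pair term is `2c_f c_g` and `12Ψ(Z) = 12·Π_f (h − α_f)`. [`ring`] -/
theorem MCell.psi12_ceiling (Z : MCell) (h : ℤ) (hZ : ∀ f, (Z f).2.1 ^ 2 + (Z f).2.2 ^ 2 = (h - (Z f).1) ^ 2) :
    Z.psi12 = 12 * ((h - (Z 0).1) * (h - (Z 1).1) * (h - (Z 2).1) * (h - (Z 3).1)) := by
  simp only [MCell.psi12, psiTwelve, hZ]
  ring

/-- **LEMMA Ψ-LINE, FLOOR**: if every letter is a pure ray or `O` — `|β_f|² = α_f²` (own coordinate `b = 0`, charge `c_f = α_f`) — then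
`12Ψ(Z) = 12·Π_f α_f`. [`ring`] -/
theorem MCell.psi12_floor (Z : MCell) (hZ : ∀ f, (Z f).2.1 ^ 2 + (Z f).2.2 ^ 2 = (Z f).1 ^ 2) :
    Z.psi12 = 12 * ((Z 0).1 * (Z 1).1 * (Z 2).1 * (Z 3).1) := by
  simp only [MCell.psi12, psiTwelve, hZ]
  ring

/-- the same for `Ψ` itself (`psiQ = psi12 ∕ 12`): ceiling line cell ⇒ `Ψ(Z) = Π_f (h − α_f)`. -/
theorem MCell.psiQ_ceiling (Z : MCell) (h : ℤ) (hZ : ∀ f, (Z f).2.1 ^ 2 + (Z f).2.2 ^ 2 = (h - (Z f).1) ^ 2) :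
    Z.psiQ = ((h - (Z 0).1) * (h - (Z 1).1) * (h - (Z 2).1) * (h - (Z 3).1) : ℤ) := by
  have e := Z.psi12_cast
  rw [Z.psi12_ceiling h hZ] at e
  push_cast at e ⊢
  linarith

/-- floor line cell ⇒ `Ψ(Z) = Π_f α_f`. -/
theorem MCell.psiQ_floor (Z : MCell) (hZ : ∀ f, (Z f).2.1 ^ 2 + (Z f).2.2 ^ 2 = (Z f).1 ^ 2) :
    Z.psiQ = ((Z 0).1 * (Z 1).1 * (Z 2).1 * (Z 3).1 : ℤ) := by
  have e := Z.psi12_cast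
  rw [Z.psi12_floor hZ] at e
  push_cast at e ⊢
  linarith

/-! ## §2 On axis cells the line products are the charge product up to sign; in the window they ARE `C±_Z = MCell.cprod` -/

/-- on an axis-or-zero letter `|β|² = chargeOf²` (exactly one of `Re β`, `Im β` is non-zero, `chargeOf = Re β − Im β`). -/
theorem normSq_eq_chargeOf_sq (x : BPoint) (hx : x.2 = (0, 0) ∨ AxisPt x) : x.2.1 ^ 2 + x.2.2 ^ 2 = chargeOf x ^ 2 := by
  obtain ⟨α, b1, b2⟩ := x
  rcases hx with h0 | ⟨-, hb2⟩ | ⟨hb1, -⟩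
  · simp only [Prod.mk.injEq] at h0
    simp [chargeOf, h0.1, h0.2]
  · simp only at hb2
    simp [chargeOf, hb2]
  · simp only at hb1
    simp [chargeOf, hb1]

/-- a CEILING cell of height `h` over axis letters, written with the signed charge: `α_f + chargeOf_f = h` on every factor (window letters
`(h−2c)I + c·ℓ_u`, `u ∈ {1, −i}`, have `chargeOf = c > 0`; their antipodes have `chargeOf = −c` and satisfy `α_f − c = h` only formally — so
this hypothesis singles out the WINDOW reading of the ceiling line, the alphabet `𝒜_{1,i}` of LEMMA FC-CORE §1 where `C_Z > 0`). Then
**`Ψ(Z) = C±_Z = MCell.cprod Z`** — LEMMA Ψ-LINE in the frame's signed vocabulary. -/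
theorem MCell.psiQ_eq_cprod_of_ceiling (Z : MCell) (h : ℤ) (hax : ∀ f, (Z f).2 = (0, 0) ∨ AxisPt (Z f))
    (hZ : ∀ f, (Z f).1 + chargeOf (Z f) = h) : Z.psiQ = (Z.cprod : ℚ) := by
  have hs : ∀ f, (Z f).2.1 ^ 2 + (Z f).2.2 ^ 2 = (h - (Z f).1) ^ 2 := fun f => by
    rw [normSq_eq_chargeOf_sq _ (hax f), show h - (Z f).1 = chargeOf (Z f) by linarith [hZ f]]
  rw [Z.psiQ_ceiling h hs, MCell.cprod, show h - (Z 0).1 = chargeOf (Z 0) by linarith [hZ 0],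
    show h - (Z 1).1 = chargeOf (Z 1) by linarith [hZ 1], show h - (Z 2).1 = chargeOf (Z 2) by linarith [hZ 2],
    show h - (Z 3).1 = chargeOf (Z 3) by linarith [hZ 3]]

/-- a FLOOR cell in the signed vocabulary: `α_f = chargeOf_f` on every factor (pure rays `c·ℓ_u`, `u ∈ {1, −i}`, and `O`). Then `Ψ(Z) = C±_Z`. -/
theorem MCell.psiQ_eq_cprod_of_floor (Z : MCell) (hax : ∀ f, (Z f).2 = (0, 0) ∨ AxisPt (Z f))
    (hZ : ∀ f, (Z f).1 = chargeOf (Z f)) : Z.psiQ = (Z.cprod : ℚ) := by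
  have hs : ∀ f, (Z f).2.1 ^ 2 + (Z f).2.2 ^ 2 = (Z f).1 ^ 2 := fun f => by
    rw [normSq_eq_chargeOf_sq _ (hax f), hZ f]
  rw [Z.psiQ_floor hs, MCell.cprod, hZ 0, hZ 1, hZ 2, hZ 3]

/-- the note's UNSIGNED reading on arbitrary axis letters (any phases): a ceiling cell `α_f + |chargeOf_f| = h` has `Ψ(Z) = Π_f |chargeOf_f|`
`= |C±_Z|` — the FC weight `C_Z` of LEMMA FC-CORE §1, phase-blind. -/
theorem MCell.psiQ_ceiling_abs (Z : MCell) (h : ℤ) (hax : ∀ f, (Z f).2 = (0, 0) ∨ AxisPt (Z f))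
    (hZ : ∀ f, (Z f).1 + |chargeOf (Z f)| = h) :
    Z.psiQ = (|chargeOf (Z 0)| * |chargeOf (Z 1)| * |chargeOf (Z 2)| * |chargeOf (Z 3)| : ℤ) := by
  have hs : ∀ f, (Z f).2.1 ^ 2 + (Z f).2.2 ^ 2 = (h - (Z f).1) ^ 2 := fun f => by
    rw [normSq_eq_chargeOf_sq _ (hax f), show h - (Z f).1 = |chargeOf (Z f)| by linarith [hZ f], sq_abs]
  rw [Z.psiQ_ceiling h hs, show h - (Z 0).1 = |chargeOf (Z 0)| by linarith [hZ 0],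
    show h - (Z 1).1 = |chargeOf (Z 1)| by linarith [hZ 1], show h - (Z 2).1 = |chargeOf (Z 2)| by linarith [hZ 2],
    show h - (Z 3).1 = |chargeOf (Z 3)| by linarith [hZ 3]]

/-- a cell with an UNCHARGED letter has `C± = 0` (so on a line cell through `hI` or `O`: `Ψ = 0`, «Ψ-null»). -/
theorem MCell.cprod_eq_zero_of_uncharged (Z : MCell) (f : Fin 4) (hf : (Z f).2 = (0, 0)) : Z.cprod = 0 := by
  have h1 : (Z f).2.1 = 0 := by rw [hf]
  have h2 : (Z f).2.2 = 0 := by rw [hf]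
  have h0 : chargeOf (Z f) = 0 := by rw [chargeOf, h1, h2]; rfl
  rw [MCell.cprod]
  fin_cases f <;> simp_all

/-! ## §3 The SIGNED Ψ-DEFECT and the PROPOSITION «Ψ-row balanced against the FC charge products ⇒ Re μ = 0» -/

/-- the (signed) Ψ-DEFECT of a cell: `δ(Z) := Ψ(Z) − [Z fully charged]·C±_Z` (g52's `δ` with the frame's signed charge product; on
window cells `C± = C > 0` and this is the note's `Ψ − [FC]·C_Z` verbatim). Zero on every window line cell (§2). -/
def MCell.psiDefect (Z : MCell) : ℚ := Z.psiQ - if FCc Z then (Z.cprod : ℚ) else 0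

/-- on a window ceiling ∕ floor cell the Ψ-defect vanishes (FC or not: a non-FC cell has an uncharged letter, `C± = 0 = Ψ`). -/
theorem MCell.psiDefect_eq_zero_of_line (Z : MCell) (hax : ∀ f, (Z f).2 = (0, 0) ∨ AxisPt (Z f))
    (hZ : (∃ h : ℤ, ∀ f, (Z f).1 + chargeOf (Z f) = h) ∨ ∀ f, (Z f).1 = chargeOf (Z f)) : Z.psiDefect = 0 := by
  have e : Z.psiQ = (Z.cprod : ℚ) := by
    rcases hZ with ⟨h, hh⟩ | hh
    · exact Z.psiQ_eq_cprod_of_ceiling h hax hh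
    · exact Z.psiQ_eq_cprod_of_floor hax hh
  unfold MCell.psiDefect
  split_ifs with hfc
  · rw [e, sub_self]
  · obtain ⟨f, hf⟩ : ∃ f, (Z f).2 = (0, 0) := by simpa [FCc] using hfc
    rw [e, Z.cprod_eq_zero_of_uncharged f hf]
    simp

/-- **THE SUM OF THE SIXTEEN FC-CORE IDENTITIES**: under `Pad4FCCore.MixedRowsVanish`, `Σ_κ x_κ = −muRe(x)∕2`
(`8x_κ = +muRe` at weights 0, 4 (2 patterns), `−muRe` at weight 2 (6), `+muIm` at weight 1 (4), `−muIm` at weight 3 (4)). -/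
theorem sum_x_of_mixedRowsVanish (x : Fin 16 → ℚ) (h : Pad4FCCore.MixedRowsVanish x) :
    ∑ κ : Fin 16, x κ = -(Pad4FCCore.muRe x) / 2 := by
  rw [sum16]
  linear_combination (Pad4FCCore.fcCore_00 x h + Pad4FCCore.fcCore_01 x h + Pad4FCCore.fcCore_02 x h + Pad4FCCore.fcCore_03 x h +
    Pad4FCCore.fcCore_04 x h + Pad4FCCore.fcCore_05 x h + Pad4FCCore.fcCore_06 x h + Pad4FCCore.fcCore_07 x h +
    Pad4FCCore.fcCore_08 x h + Pad4FCCore.fcCore_09 x h + Pad4FCCore.fcCore_10 x h + Pad4FCCore.fcCore_11 x h +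
    Pad4FCCore.fcCore_12 x h + Pad4FCCore.fcCore_13 x h + Pad4FCCore.fcCore_14 x h + Pad4FCCore.fcCore_15 x h) / 8

/-- the sum of the parity aggregates is the FC part of the weighted charge-product row: `Σ_κ X_κ = Σ_{N FC} m C± − Σ_{P FC} m C±`. -/
theorem MConfig.sum_xPat (C : MConfig) (mN mP : MCell → ℤ) :
    ∑ κ : Fin 16, C.xPat mN mP κ =
      ∑ Z ∈ C.lower, mN Z * (if FCc Z then Z.cprod else 0) - ∑ P ∈ C.upper, mP P * (if FCc P then P.cprod else 0) := by
  have key : ∀ (S : Finset MCell) (m : MCell → ℤ),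
      ∑ κ : Fin 16, ∑ Z ∈ S.filter (fun Z => FCc Z ∧ Z.pat = κ), m Z * Z.cprod = ∑ Z ∈ S, m Z * (if FCc Z then Z.cprod else 0) := by
    intro S m
    have h1 : ∑ Z ∈ S, m Z * (if FCc Z then Z.cprod else 0) = ∑ Z ∈ S.filter FCc, m Z * Z.cprod := by
      rw [Finset.sum_filter]
      exact Finset.sum_congr rfl fun Z _ => by split_ifs <;> simp
    rw [h1, ← Finset.sum_fiberwise (S.filter FCc) MCell.pat]
    exact Finset.sum_congr rfl fun κ _ => by rw [Finset.filter_filter]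
  simp only [MConfig.xPat, Finset.sum_sub_distrib, key]

/-- **PROPOSITION (gs-eng-2 g52, LEMMA Ψ-LINE note §2: «Ψ-ROW = FC-CORE SUM ⇒ Re μ = 0»), for every weighted 𝔅(μ₄) configuration whose
fully charged classes are axis cells**: if the weighted class tensor passes (A1) and the signed Ψ-defect is level-balanced
(`Σ_N m δ = Σ_P m δ`, e.g. `δ ≡ 0` on the support), then `Re wch(ēēēē) = 0 = Re wch(eeee)` — the EVEN core cannot carry μ. Proof: the
Ψ-row ((B) `psiRow_of_classScreen`) minus the δ-row is the FC charge-product row `Σ_κ X_κ = 0`; by FC-CORE ((J) `mixedRowsVanish_of_classScreen_axis`,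
`mu_fcCore_axis`) that sum is `−Re μ∕2`. -/
theorem MConfig.muRe_eq_zero_of_psiDefect_balance (C : MConfig) (mN mP : MCell → ℤ) (hN : ∀ Z ∈ C.lower, FCc Z → AxisCell Z)
    (hP : ∀ P ∈ C.upper, FCc P → AxisCell P) (hA : ClassScreen (C.wch mN mP))
    (hδ : ∑ Z ∈ C.lower, (mN Z : ℚ) * Z.psiDefect = ∑ P ∈ C.upper, (mP P : ℚ) * P.psiDefect) :
    (C.wch mN mP ebarWord).re = 0 ∧ (C.wch mN mP eWord).re = 0 := by
  have hψ := C.psiRow_of_classScreen mN mP hA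
  have hsum := sum_x_of_mixedRowsVanish _ (C.mixedRowsVanish_of_classScreen_axis mN mP hN hP hA)
  rw [(C.mu_fcCore_axis mN mP hN hP).1] at hsum
  have hx : (∑ κ : Fin 16, (C.xPat mN mP κ : ℚ)) =
      ∑ Z ∈ C.lower, (mN Z : ℚ) * (if FCc Z then (Z.cprod : ℚ) else 0) -
        ∑ P ∈ C.upper, (mP P : ℚ) * (if FCc P then (P.cprod : ℚ) else 0) := by
    have := congrArg (Int.cast : ℤ → ℚ) (C.sum_xPat mN mP)
    push_cast at this
    rw [this]
  have hdef : ∀ Z : MCell, (if FCc Z then (Z.cprod : ℚ) else 0) = Z.psiQ - Z.psiDefect := fun Z => by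
    rw [MCell.psiDefect]; ring
  simp only [hdef, mul_sub, Finset.sum_sub_distrib, hψ, hδ, sub_self] at hx
  have hre : ((C.wch mN mP ebarWord).re : ℚ) = 0 := by linarith
  have hre' : (C.wch mN mP ebarWord).re = 0 := by exact_mod_cast hre
  refine ⟨hre', ?_⟩
  rw [C.wch_ebarWord_eq_star mN mP] at hre'
  simpa using hre'

/-- **COROLLARY (the ODD core is forced)**: under the same hypotheses plus `μ ≠ 0`, the support holds present fully charged classes of
parity weights 1 AND 3 (patterns `0001` and `0111`; with 919's signs) — the even menu `{0000, 0011, 1111}` alone never suffices on a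
δ-balanced support, whatever the multiplicities. -/
theorem MConfig.odd_core_of_psiDefect_balance (C : MConfig) (mN mP : MCell → ℤ) (hN : ∀ Z ∈ C.lower, FCc Z → AxisCell Z)
    (hP : ∀ P ∈ C.upper, FCc P → AxisCell P) (hA : ClassScreen (C.wch mN mP))
    (hδ : ∑ Z ∈ C.lower, (mN Z : ℚ) * Z.psiDefect = ∑ P ∈ C.upper, (mP P : ℚ) * P.psiDefect) (hμ : C.wch mN mP eWord ≠ 0) :
    (C.wch mN mP ebarWord).im ≠ 0 ∧ C.HasFC 1 ∧ C.HasFC 7 := by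
  obtain ⟨hre, -⟩ := C.muRe_eq_zero_of_psiDefect_balance mN mP hN hP hA hδ
  have hμ' := (C.wch_ebarWord_ne_zero_iff mN mP).2 hμ
  have him : (C.wch mN mP ebarWord).im ≠ 0 := fun him => hμ' (Zsqrtd.ext hre him)
  refine ⟨him, ?_⟩
  have hodd := Pad4FCCore.ne_zero_odd_of_muIm_ne _ (C.mixedRowsVanish_of_classScreen_axis mN mP hN hP hA)
    (by rw [(C.mu_fcCore_axis mN mP hN hP).2]; exact_mod_cast him)
  obtain ⟨h1, -, -, h7, -, -, -, -⟩ := hodd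
  exact ⟨C.exists_of_xPat_ne mN mP 1 h1, C.exists_of_xPat_ne mN mP 7 h7⟩

/-! ## §4 Probes (`decide` on closed integer terms) -/

/-- the CEILING UNIT CELL `P[6I+ℓ₁ | 6I+ℓ_{i³} | 6I+ℓ₁ | 6I+ℓ_{i³}]` of height 8 (the FC shape of all 14 static-clean ◇₈ survivors, g52
OBS-CEILING-UNIT-CELL): letters `(7, ±…)` with `α + chargeOf = 8`; `12Ψ = 12`, `C± = 1`, fully charged — so `δ = 0`. -/
def cuCell : MCell := ![ray (6, 0, 0) 0 1, ray (6, 0, 0) 1 1, ray (6, 0, 0) 0 1, ray (6, 0, 0) 1 1]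

/-- g52's off-line example `N[4I | ℓ | ℓ | ℓ]`: `12Ψ = −48` (`Ψ = −4`) while the cell is not fully charged (`C±`-term `0`): defect `−4 ≠ 0`. -/
def offCell : MCell := ![(4, 0, 0), lpt 1 0, lpt 1 0, lpt 1 0]

/-- PROBE: the numbers above, and the ceiling hypothesis of §2 on `cuCell` at `h = 8`. [kernel, `decide`] -/
theorem psiLine_probe :
    cuCell.psi12 = 12 ∧ cuCell.cprod = 1 ∧ (∀ f, (cuCell f).2 ≠ (0, 0)) ∧ (∀ f, (cuCell f).1 + chargeOf (cuCell f) = 8) ∧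
      (∀ f, (cuCell f).2 = (0, 0) ∨ AxisPt (cuCell f)) ∧ offCell.psi12 = -48 ∧ ¬ (∀ f, (offCell f).2 ≠ (0, 0)) ∧ offCell.cprod = 0 := by
  refine ⟨by decide, by decide, by decide, by decide, by decide, by decide, by decide, by decide⟩

/-- the probe's consequence through §2–§3: `Ψ(cuCell) = C± = 1` and its signed Ψ-defect vanishes. -/
theorem psiLine_probe_defect : cuCell.psiQ = 1 ∧ cuCell.psiDefect = 0 := by
  obtain ⟨-, hc, -, hh, hax, -⟩ := psiLine_probe
  have e : cuCell.psiQ = (cuCell.cprod : ℚ) := cuCell.psiQ_eq_cprod_of_ceiling 8 hax hh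
  refine ⟨by rw [e, hc]; simp, ?_⟩
  exact cuCell.psiDefect_eq_zero_of_line hax (Or.inl ⟨8, hh⟩)

end Summit.Ventures.HSemireg.Pad4Tower
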